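import Summits.ResolutionOfSingularities.ResolutionOfSingularities.Theorems.WeightedInvariantKeyRungThreeClosures
import Summits.ResolutionOfSingularities.ResolutionOfSingularities.Theorems.WeightedInvariantIotaFlatTTorusFactorUnconditional
import Summits.ResolutionOfSingularities.ResolutionOfSingularities.Theorems.WeightedInvariantHypersurfaceLocalGameEFT4Seams
import Summits.ResolutionOfSingularities.ResolutionOfSingularities.Theorems.WeightedInvariantHypersurfaceLocalGameEFT4SSeams
import Summits.ResolutionOfSingularities.ResolutionOfSingularities.Theorems.WeightedInvariantRegularParameterExtension
import Summits.ResolutionOfSingularities.ResolutionOfSingularities.Theorems.WeightedInvariantContactCylinderGenericSuccessor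
import Summits.ResolutionOfSingularities.ResolutionOfSingularities.Theorems.WeightedInvariantWeightedConstructionWeightedChartBasicOpen
import Literature.AlgebraicGeometry.Resolution.RsopMonomialIdeals
import Literature.AlgebraicGeometry.Resolution.StrictNormalCrossingsAt
import Literature.RingTheory.KrullDimension.LocalizationDimension
import HarnessLib

/-!
# (PRES)₃ PROVED: the weighted regular system of parameters presenting the canonical centre `P` and `J₃ᵗ` at every
# door position of dimension `≤ 3`; gap list of `stub_keyRungGrHomLE_three` = hD (typing) + (DROP)₃
# (door `HypersurfaceCentreConstruction`, stmt-ResolutionOfSingularities-19897)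

Helper for `stub_keyRungGrHomLE_three` (def-free, `--supports 19897`).  Sequel of …KeyRungThreeOfPresDrop / …KeyRungThreeClosures
(gap lists `keyRungGrHomLE_three_of_pres_drop` (hD, hPRES, hDROP) and `pRungGrHomLE_three_of_pres_drop`).  The hypothesis
hPRES = (PRES)₃ is DISCHARGED here:

* **`Iota3.weightedPresentation_three`** — `k₀` perfect of characteristic `p`, `S` regular local essentially of finite type over
  `k₀`, `dim S ≤ 3`, `0 ≠ f ∈ 𝔪_S²`, `P` a prime with `f ∈ P` and `topStratum ι₀ S f = V(P)` (`ι₀ = iotaOrdEpsTau`).  Then there is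
  a regular system of parameters `u : Fin n → S` (`span u = 𝔪_S`, `𝔪_S.spanFinrank = n`) with weights `w`, some positive, such that
  `span {u_i : w_i > 0} = P` and `weightedMonomialIdeal u w m = jFlatT S f m` for every `m`.

  Proof (the plan of Cruxes/HypersurfaceCentreConstruction/CLOSURES.md §3): realise `S ≅ A_𝔪` by a finite-type model through `f`
  (`exists_finiteType_model`); read the UNCONDITIONAL (open″)≤3 body `jOpenPresentationForallSingLE_three` at the model position
  `(A, 𝔪, F)` and at `𝔮 = 𝔪`: a positively weighted `U ⊆ 𝔪` with independent differentials and
  `J₃ᵗ(A_𝔪)(F) = (U; W)_m A_𝔪`; transport along `A_𝔪 ≃ S` ((c5) `jFlatT_isoInvariant`); pad `U` by weight-`0` members to a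
  minimal system of generators of `𝔪_S` (`RspExtension.exists_rsp_extension`, `ContactCylinder.weightedMonomialIdeal_append_zero'`);
  finally `span U = P`: both are prime (`IsRsopPart.isPrime_span_range`; `P` by hypothesis) and cut out the same set of primes —
  at a prime `𝔭` of `S` over `𝔮 ⊆ 𝔪`, `A_𝔮 ≃ S_𝔭` carries the body's stratum iff `U ⊆ 𝔮 ↔ (F ∈ 𝔪_{A_𝔮}² ∧ ι₃ᵗ(A_𝔮) = ι₃ᵗ(A_𝔪))`
  ((c6) `iotaFlatT_isoInvariant`) onto `U ⊆ 𝔭 ↔ P ≤ 𝔭`, because on the `S` side `ι₃ᵗ(S_𝔭) = ι₃ᵗ(S) ↔ P ≤ 𝔭`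
  (`iotaFlatT_eq_iff`, (c7-cyl) `iota_localization_eq_of_topStratum_eq` / `iotaCylinder_localization_eq`) and `f ∈ 𝔪_{S_𝔭}²` along
  `V(P)` (`algebraMap_mem_maximalIdeal_sq_of_topStratum`).
* **`canonicalGameClauseHomLE_three_of_drop`** — hgame `CanonicalGameClauseHomLE 3 p iotaFlatT jFlatT` ⟸ (DROP)₃ ALONE.
* **`pRungGrHomLE_three_of_tieDescent_drop`**, **`keyRungGrHomLE_three_of_tieDescent_drop`** — NEW GAP LISTS OF RECORD:
  `PRungGrHomLE 3 p iotaFlatT jFlatT` / `KeyRungGrHomLE 3 p` from hD ((desc-τ) as typed; door-proved, typing item) and (DROP)₃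
  (`WeightedDropHom iotaFlatT S f P u w` for every weighted presentation of the canonical centre — the characteristic-`p` drop, the
  substance of the crux); **`keyRungGrHomLE_three_of_c11_drop`**: the same with (c11)≤3 in place of hD.

[OURS · L1 W4.3 · audit glue + commutative algebra; AI work, weaker than expert review; nothing here is a statement of the manuscript
under review (Hironaka 2017, [claim: Hironaka2017, status: under-review]).]

## References

* J. Włodarczyk, *Functorial resolution except for toroidal locus. Toroidal compactification*, Adv. Math. 407 (2022), Lemma 2.1.12
  (weighted monomial ideals; weight-`0` padding). [Wlodarczyk2022]
* H. Matsumura, *Commutative Ring Theory* (1987), Thm. 14.2/14.3 (regular systems of parameters, regular quotients are domains),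
  §4 (primes of a localisation). [Matsumura1987]
* res-L1-w43-plan-1 IOTA3-DESIGN v1.3 §8 and Cruxes/HypersurfaceCentreConstruction/CLOSURES.md §3 (OURS, AI planning).
-/

noncomputable section

set_option linter.dupNamespace false -- mandated namespace of this single-conjunct summit

open IsLocalRing Literature.AlgebraicGeometry.Resolution
open Summit.ResolutionOfSingularities.ResolutionOfSingularities.Theorems
open Summit.ResolutionOfSingularities.ResolutionOfSingularities.Theorems.ContactCylinder
open Summit.ResolutionOfSingularities.ResolutionOfSingularities.Theorems.JOpenLE3

namespace Summit.ResolutionOfSingularities.ResolutionOfSingularities.Cruxes.HypersurfaceCentreConstruction.LocalEngine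

namespace Iota3

/-! ## §1 Small transport bricks -/

/-- Weighted monomial ideals extend generator by generator along a ring ISOMORPHISM (the `RingEquiv` form of
`weightedMonomialIdeal_map`, matching the shape `(J R g m).map e` of `JIsoInvariant`). [cite: Wlodarczyk2022, Lemma 2.1.12] -/
theorem weightedMonomialIdeal_map_ringEquiv {A B : Type} [CommRing A] [CommRing B] (e : A ≃+* B) {n : ℕ}
    (u : Fin n → A) (w : Fin n → ℕ) (m : ℕ) :
    (weightedMonomialIdeal u w m).map e = weightedMonomialIdeal (fun i => e (u i)) w m := by
  have h : (weightedMonomialIdeal u w m).map e = (weightedMonomialIdeal u w m).map (e : A →+* B) := rfl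
  rw [h, weightedMonomialIdeal_map]
  rfl

/-- The positively weighted members of a padded family `(v, y; W, 0)` with ALL `W i > 0` are exactly the members of `v`.
[folklore] -/
theorem setOf_pos_weight_append_zero {S : Type} {N r : ℕ} (v : Fin N → S) (y : Fin r → S) (W : Fin N → ℕ)
    (hW : ∀ i, 0 < W i) :
    {x | ∃ i, 0 < (Fin.append W (fun _ : Fin r => 0) : Fin (N + r) → ℕ) i ∧ x = Fin.append v y i} = Set.range v := by
  ext x
  simp only [Set.mem_setOf_eq, Set.mem_range]
  constructor
  · rintro ⟨i, hi, rfl⟩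
    induction i using Fin.addCases with
    | left j => exact ⟨j, by rw [Fin.append_left]⟩
    | right j =>
      rw [Fin.append_right] at hi
      exact absurd hi (lt_irrefl 0)
  · rintro ⟨j, rfl⟩
    exact ⟨Fin.castAdd r j, by rw [Fin.append_left]; exact hW j, by rw [Fin.append_left]⟩

/-- Linear independence of differentials transports along an isomorphism of local rings (criterion
`linearIndependent_toCotangent_iff_forall_mem`: a relation `∑ cᵢ xᵢ ∈ 𝔪²` forces `cᵢ ∈ 𝔪`). [folklore] -/
theorem linearIndependent_toCotangent_of_ringEquiv {L S : Type} [CommRing L] [IsLocalRing L] [CommRing S] [IsLocalRing S]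
    (e : L ≃+* S) {N : ℕ} (x : Fin N → L) (hx : ∀ i, x i ∈ maximalIdeal L)
    (hli : LinearIndependent (ResidueField L) (fun i => (maximalIdeal L).toCotangent ⟨x i, hx i⟩))
    (hex : ∀ i, e (x i) ∈ maximalIdeal S) :
    LinearIndependent (ResidueField S) (fun i => (maximalIdeal S).toCotangent ⟨e (x i), hex i⟩) := by
  rw [linearIndependent_toCotangent_iff_forall_mem] at hli ⊢
  intro c hc i
  have hc' : ∑ j, e.symm (c j) * x j ∈ (maximalIdeal L) ^ 2 := by
    have hsum : e.symm (∑ j, c j * e (x j)) = ∑ j, e.symm (c j) * x j := by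
      rw [map_sum]
      refine Finset.sum_congr rfl fun j _ => ?_
      rw [map_mul, RingEquiv.symm_apply_apply]
    rw [← hsum]
    exact mem_sq_maximalIdeal_of_ringEquiv_apply e (by rw [RingEquiv.apply_symm_apply]; exact hc)
  have hj := hli (fun j => e.symm (c j)) hc' i
  have hu : ¬ IsUnit (e.symm (c i)) := mem_nonunits_iff.mp ((IsLocalRing.mem_maximalIdeal _).mp hj)
  rw [IsLocalRing.mem_maximalIdeal, mem_nonunits_iff]
  exact fun h => hu ((isUnit_map_iff e.symm (c i)).mpr h)

/-! ## §2 The stationarity iff of `ι₃ᵗ` along the canonical centre -/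

/-- **`ι₃ᵗ` is stationary at `S_𝔭` exactly for `𝔭 ⊇ P`** when `topStratum ι₀ S f = V(P)` (`S` regular local of dimension `≤ 3`;
forward by `iotaFlatT_eq_iff`, backward by (c7-cyl) `iota_localization_eq_of_topStratum_eq` / `iotaCylinder_localization_eq`).
[OURS · L1 W4.3 · (strat-τ)] -/
theorem iotaFlatT_localization_eq_iff_of_topStratum_eq (S : Type) [CommRing S] [IsRegularLocalRing S] {f : S} {P : Ideal S}
    [P.IsPrime] (hE : topStratum iotaOrdEpsTau S f = {𝔮 | P ≤ 𝔮.asIdeal}) (𝔭 : Ideal S) [𝔭.IsPrime] :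
    iotaFlatT (Localization.AtPrime 𝔭) (algebraMap S (Localization.AtPrime 𝔭) f) = iotaFlatT S f ↔ P ≤ 𝔭 := by
  constructor
  · intro h
    have h0 := ((iotaFlatT_eq_iff _ _ _ _).mp h).1
    have hmem : (⟨𝔭, ‹_›⟩ : PrimeSpectrum S) ∈ topStratum iotaOrdEpsTau S f := h0
    rw [hE] at hmem
    exact hmem
  · intro h𝔭
    rw [iotaFlatT_eq_iff]
    exact ⟨iota_localization_eq_of_topStratum_eq S P 𝔭 h𝔭 f hE,
      iotaCylinder_localization_eq iotaOrdEpsTau_isoInvariant iotaSigma_isoInvariant S P 𝔭 h𝔭 f hE⟩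

/-! ## §3 (PRES)₃ at a finite-type model, and at every door position -/

/-- **(PRES)₃ AT A FINITE-TYPE MODEL.**  `k₀` perfect of characteristic `p`, `A` of finite type over `k₀`, `𝔪` a prime of `A`, `S` a
localisation of `A` at `𝔪` which is a regular local ring of dimension `≤ 3`, `F ∈ A` with `0 ≠ F/1 ∈ 𝔪_S²`, and `P` a prime of `S` with
`F/1 ∈ P` and `topStratum ι₀ S (F/1) = V(P)`.  Then some regular system of parameters `u : Fin n → S` (`span u = 𝔪_S`,
`𝔪_S.spanFinrank = n`) with weights `w` (some positive) has `span {u_i : w_i > 0} = P` and `weightedMonomialIdeal u w m = jFlatT S (F/1) m`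
for all `m`.  (The unconditional (open″)≤3 body `jOpenPresentationForallSingLE_three` at `(A, 𝔪, F)`, read at `𝔮 = 𝔪` and transported
along `A_𝔪 ≃ S`; weight-`0` padding; `V(U) = V(P)` with both prime — see the module docstring.) [OURS · L1 W4.3 · (PRES)₃] -/
theorem weightedPresentation_three_model (p : ℕ) (k₀ : Type) [Field k₀] [CharP k₀ p] [PerfectField k₀]
    (A : Type) [CommRing A] [Algebra k₀ A] [Algebra.FiniteType k₀ A] (𝔪 : Ideal A) [𝔪.IsPrime] (F : A)
    (S : Type) [CommRing S] [Algebra A S] [IsLocalization.AtPrime S 𝔪] [IsRegularLocalRing S]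
    (hd : ringKrullDim S ≤ 3) (hf0 : algebraMap A S F ≠ 0) (hf2 : algebraMap A S F ∈ (maximalIdeal S) ^ 2)
    (P : Ideal S) [P.IsPrime] (hfP : algebraMap A S F ∈ P)
    (hE : topStratum iotaOrdEpsTau S (algebraMap A S F) = {𝔮 | P ≤ 𝔮.asIdeal}) :
    ∃ (n : ℕ) (u : Fin n → S) (w : Fin n → ℕ),
      Ideal.span (Set.range u) = maximalIdeal S ∧ (maximalIdeal S).spanFinrank = n ∧ (∃ i, 0 < w i) ∧
      Ideal.span {x | ∃ i, 0 < w i ∧ x = u i} = P ∧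
      (∀ m : ℕ, weightedMonomialIdeal u w m = jFlatT S (algebraMap A S F) m) := by
  classical
  have hd' : ringKrullDim S ≤ (3 : ℕ) := by exact_mod_cast hd
  -- the model isomorphism `e : A_𝔪 ≃ S`
  let eA : Localization.AtPrime 𝔪 ≃ₐ[A] S := IsLocalization.algEquiv 𝔪.primeCompl (Localization.AtPrime 𝔪) S
  let e : Localization.AtPrime 𝔪 ≃+* S := eA.toRingEquiv
  have heA : ∀ a : A, e (algebraMap A (Localization.AtPrime 𝔪) a) = algebraMap A S a := fun a => eA.commutes a
  have hreg : IsRegularLocalRing (Localization.AtPrime 𝔪) := IsRegularLocalRing.of_ringEquiv e.symm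
  have hF0 : algebraMap A (Localization.AtPrime 𝔪) F ≠ 0 :=
    ne_zero_of_ringEquiv_apply_ne_zero e (by rw [heA]; exact hf0)
  have hF2 : algebraMap A (Localization.AtPrime 𝔪) F ∈ (maximalIdeal (Localization.AtPrime 𝔪)) ^ 2 :=
    mem_sq_maximalIdeal_of_ringEquiv_apply e (by rw [heA]; exact hf2)
  have hdimL : ringKrullDim (Localization.AtPrime 𝔪) ≤ (3 : ℕ) := by
    rw [ringKrullDim_eq_of_ringEquiv e]; exact hd'
  -- the unconditional (open″)≤3 body at the model position, read at `𝔮 = 𝔪`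
  obtain ⟨h, hh𝔪, N, U, W, hW, ⟨hUL, hli⟩, hall⟩ :=
    (jOpenPresentationForallSingLE_three_iff p iotaFlatT jFlatT).mp (jOpenPresentationForallSingLE_three p)
      k₀ A 𝔪 F hreg hdimL hF0 hF2
  obtain ⟨hiff𝔪, hpres𝔪⟩ := hall 𝔪 hh𝔪 hdimL
  have hU𝔪 : ∀ i, U i ∈ 𝔪 := hiff𝔪.mpr ⟨hF2, rfl⟩
  -- the system in `S`
  let u₀ : Fin N → S := fun i => algebraMap A S (U i)
  have hu₀ : ∀ i, u₀ i ∈ maximalIdeal S := fun i => by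
    have h1 : IsUnit (algebraMap A S (U i)) → False := fun hu =>
      (IsLocalization.AtPrime.isUnit_to_map_iff S 𝔪 (U i)).mp hu (hU𝔪 i)
    exact (IsLocalRing.mem_maximalIdeal _).mpr (mem_nonunits_iff.mpr h1)
  have heU : ∀ i, e (algebraMap A (Localization.AtPrime 𝔪) (U i)) = u₀ i := fun i => heA (U i)
  -- presentation of `J₃ᵗ S (F/1)` by `(u₀; W)`
  have hJ : ∀ m : ℕ, jFlatT S (algebraMap A S F) m = weightedMonomialIdeal u₀ W m := by
    intro m
    have h1 := hpres𝔪 hU𝔪 m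
    have h2 := jFlatT_isoInvariant _ _ e (algebraMap A (Localization.AtPrime 𝔪) F) m
    rw [heA] at h2
    rw [h2, h1, weightedMonomialIdeal_map, weightedMonomialIdeal_map_ringEquiv]
    congr 1
    funext i
    exact heU i
  -- independent differentials in `S`, and the padding to a minimal system of generators of `𝔪_S`
  have hli₀ : LinearIndependent (ResidueField S) (fun i => (maximalIdeal S).toCotangent ⟨u₀ i, hu₀ i⟩) := by
    have h := linearIndependent_toCotangent_of_ringEquiv e (fun i => algebraMap A (Localization.AtPrime 𝔪) (U i)) hUL hli
      (fun i => by rw [heU i]; exact hu₀ i)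
    convert h using 3 with i
    exact Subtype.ext (heU i).symm
  obtain ⟨r, y, -, hspan, hrank⟩ := RspExtension.exists_rsp_extension S u₀ hu₀ hli₀
  -- `span u₀` is prime
  have hrsop : IsRsopPart u₀ := by
    have h := isRsopPart_comp_of_rsop hrank (Fin.append u₀ y) hspan (Fin.castAdd r) (Fin.castAdd_injective N r)
    rwa [show Fin.append u₀ y ∘ Fin.castAdd r = u₀ from funext fun i => by simp] at h
  haveI hprime : (Ideal.span (Set.range u₀)).IsPrime := hrsop.isPrime_span_range
  -- `V(u₀) = V(P)`
  have hV : ∀ (𝔭 : Ideal S) [𝔭.IsPrime], (∀ i, u₀ i ∈ 𝔭) ↔ P ≤ 𝔭 := by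
    intro 𝔭 _
    let 𝔮 : Ideal A := 𝔭.comap (algebraMap A S)
    haveI h𝔮 : 𝔮.IsPrime := Ideal.IsPrime.comap _
    have h𝔮𝔪 : 𝔮 ≤ 𝔪 := Iota3.comap_le_of_isLocalization_atPrime 𝔪 S 𝔭
    have hh𝔮 : h ∉ 𝔮 := fun hq => hh𝔪 (h𝔮𝔪 hq)
    -- `A_𝔮 ≃ S_𝔭` over `A`
    haveI : IsLocalization.AtPrime (Localization.AtPrime 𝔭) 𝔮 :=
      IsLocalization.isLocalization_isLocalization_atPrime_isLocalization 𝔪.primeCompl (Localization.AtPrime 𝔭) 𝔭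
    let e𝔮 : Localization.AtPrime 𝔮 ≃ₐ[A] Localization.AtPrime 𝔭 :=
      IsLocalization.algEquiv 𝔮.primeCompl (Localization.AtPrime 𝔮) (Localization.AtPrime 𝔭)
    have he𝔮 : e𝔮.toRingEquiv (algebraMap A (Localization.AtPrime 𝔮) F) =
        algebraMap S (Localization.AtPrime 𝔭) (algebraMap A S F) := by
      change e𝔮 (algebraMap A (Localization.AtPrime 𝔮) F) = _
      rw [AlgEquiv.commutes, IsScalarTower.algebraMap_apply A S (Localization.AtPrime 𝔭)]
    have hdim𝔮 : ringKrullDim (Localization.AtPrime 𝔮) ≤ (3 : ℕ) := by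
      rw [ringKrullDim_eq_of_ringEquiv e𝔮.toRingEquiv]
      exact (Literature.RingTheory.KrullDimension.ringKrullDim_localization_atPrime_le 𝔭).trans hd'
    obtain ⟨hiff, -⟩ := hall 𝔮 hh𝔮 hdim𝔮
    -- the three transports
    have hι𝔮 : iotaFlatT (Localization.AtPrime 𝔮) (algebraMap A (Localization.AtPrime 𝔮) F) =
        iotaFlatT (Localization.AtPrime 𝔭) (algebraMap S (Localization.AtPrime 𝔭) (algebraMap A S F)) := by
      rw [← he𝔮]
      exact (iotaFlatT_isoInvariant _ _ e𝔮.toRingEquiv _).symm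
    have hι𝔪 : iotaFlatT (Localization.AtPrime 𝔪) (algebraMap A (Localization.AtPrime 𝔪) F) =
        iotaFlatT S (algebraMap A S F) := by
      rw [← heA]
      exact (iotaFlatT_isoInvariant _ _ e _).symm
    have hsq : algebraMap A (Localization.AtPrime 𝔮) F ∈ (maximalIdeal (Localization.AtPrime 𝔮)) ^ 2 ↔
        algebraMap S (Localization.AtPrime 𝔭) (algebraMap A S F) ∈ (maximalIdeal (Localization.AtPrime 𝔭)) ^ 2 := by
      constructor
      · intro hm
        rw [← he𝔮]
        exact mem_sq_maximalIdeal_of_ringEquiv_apply e𝔮.toRingEquiv.symm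
          (by rw [RingEquiv.symm_apply_apply]; exact hm)
      · intro hm
        exact mem_sq_maximalIdeal_of_ringEquiv_apply e𝔮.toRingEquiv (by rw [he𝔮]; exact hm)
    have hcomap : (∀ i, U i ∈ 𝔮) ↔ ∀ i, u₀ i ∈ 𝔭 := Iff.rfl
    rw [← hcomap, hiff, hsq, hι𝔮, hι𝔪, iotaFlatT_localization_eq_iff_of_topStratum_eq S hE 𝔭]
    exact ⟨fun h2 => h2.2, fun h𝔭 => ⟨algebraMap_mem_maximalIdeal_sq_of_topStratum S hf2 hE 𝔭 h𝔭, h𝔭⟩⟩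
  -- hence `span u₀ = P`
  have hspanP : Ideal.span (Set.range u₀) = P := by
    apply le_antisymm
    · rw [Ideal.span_le]
      rintro _ ⟨i, rfl⟩
      exact (hV P).mpr le_rfl i
    · have hle : P ≤ (Ideal.span (Set.range u₀)).radical := by
        rw [Ideal.radical_eq_sInf]
        refine le_sInf ?_
        rintro J ⟨hJ, hJprime⟩
        haveI := hJprime
        exact (hV J).mp fun i => hJ (Ideal.subset_span ⟨i, rfl⟩)
      rwa [hprime.radical] at hle
  -- `N > 0` since `0 ≠ F/1 ∈ P`
  have hN : 0 < N := by
    rcases Nat.eq_zero_or_pos N with hN0 | hN0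
    · exfalso
      subst hN0
      have hbot : Ideal.span (Set.range u₀) = ⊥ := by
        rw [Ideal.span_eq_bot]
        rintro _ ⟨i, rfl⟩
        exact Fin.elim0 i
      rw [hspanP] at hbot
      exact hf0 (by rw [hbot] at hfP; exact (Ideal.mem_bot).mp hfP)
    · exact hN0
  refine ⟨N + r, Fin.append u₀ y, Fin.append W (fun _ => 0), hspan, hrank,
    ⟨Fin.castAdd r ⟨0, hN⟩, by rw [Fin.append_left]; exact hW _⟩, ?_, fun m => ?_⟩
  · rw [setOf_pos_weight_append_zero u₀ y W hW, hspanP]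
  · rw [weightedMonomialIdeal_append_zero', hJ m]

/-- **(PRES)₃ — THE WEIGHTED PRESENTATION OF `(P, J₃ᵗ)` AT THE CANONICAL CENTRE.**  `k₀` perfect of characteristic `p`; `S` regular
local, essentially of finite type over `k₀`, `dim S ≤ 3`; `0 ≠ f ∈ 𝔪_S²`; `P` prime with `f ∈ P` and `topStratum ι₀ S f = V(P)`.  Then
some regular system of parameters `u : Fin n → S` (`span u = 𝔪_S`, `𝔪_S.spanFinrank = n`) with weights `w` (some positive) has
`span {u_i : w_i > 0} = P` and `weightedMonomialIdeal u w m = jFlatT S f m` for all `m` — literally the hypothesis hPRES of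
`keyRungGrHomLE_three_of_pres_drop` (the regularity of `S ⧸ P` there is not needed).  Finite-type model through `f`
(`exists_finiteType_model`) + `weightedPresentation_three_model`. [OURS · L1 W4.3 · (PRES)₃] -/
theorem weightedPresentation_three (p : ℕ) (k₀ : Type) [Field k₀] [CharP k₀ p] [PerfectField k₀]
    (S : Type) [CommRing S] [Algebra k₀ S] [Algebra.EssFiniteType k₀ S] [IsRegularLocalRing S]
    {f : S} (hd : ringKrullDim S ≤ 3) (hf0 : f ≠ 0) (hf2 : f ∈ (maximalIdeal S) ^ 2)
    (P : Ideal S) [P.IsPrime] (hfP : f ∈ P) (hE : topStratum iotaOrdEpsTau S f = {𝔮 | P ≤ 𝔮.asIdeal}) :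
    ∃ (n : ℕ) (u : Fin n → S) (w : Fin n → ℕ),
      Ideal.span (Set.range u) = maximalIdeal S ∧ (maximalIdeal S).spanFinrank = n ∧ (∃ i, 0 < w i) ∧
      Ideal.span {x | ∃ i, 0 < w i ∧ x = u i} = P ∧
      (∀ m : ℕ, weightedMonomialIdeal u w m = jFlatT S f m) := by
  obtain ⟨A, hAfg, hfA, hloc⟩ := exists_finiteType_model k₀ S f
  haveI : Algebra.FiniteType k₀ A := (Subalgebra.fg_iff_finiteType A).mp hAfg
  haveI := hloc
  exact weightedPresentation_three_model p k₀ A ((maximalIdeal S).comap (algebraMap A S)) ⟨f, hfA⟩ S hd hf0 hf2 P hfP hE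

end Iota3

open Iota3

/-! ## §4 hgame ⟸ (DROP)₃; the gap lists of record -/

/-- **hgame ⟸ (DROP)₃ ALONE.**  `CanonicalGameClauseHomLE 3 p iotaFlatT jFlatT` follows from the weighted drop
`WeightedDropHom iotaFlatT S f P u w` at every weighted presentation `(u, w)` of the canonical centre `P` (prime, `S ⧸ P` regular,
`f ∈ P`, `topStratum ι₀ S f = V(P)`) of a door position (`dim S ≤ 3`, `0 ≠ f ∈ 𝔪²`): the centre, its `ι₃ᵗ`/`J₃ᵗ` characterisation
(`exists_canonicalCentre_iotaFlatT`), the order condition (`algebraMap_mem_maximalIdeal_sq_of_topStratum`) and now the presentation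
(`weightedPresentation_three`) are all discharged. [OURS · L1 W4.3 · audit glue] -/
theorem canonicalGameClauseHomLE_three_of_drop (p : ℕ)
    (hDROP : ∀ (k₀ : Type) [Field k₀] [CharP k₀ p] [PerfectField k₀]
      (S : Type) [CommRing S] [Algebra k₀ S] [Algebra.EssFiniteType k₀ S] [IsRegularLocalRing S]
      (f : S), ringKrullDim S ≤ 3 → f ≠ 0 → f ∈ (maximalIdeal S) ^ 2 →
      ∀ (P : Ideal S) [P.IsPrime], IsRegularLocalRing (S ⧸ P) → f ∈ P →
        topStratum iotaOrdEpsTau S f = {𝔮 | P ≤ 𝔮.asIdeal} →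
        ∀ (n : ℕ) (u : Fin n → S) (w : Fin n → ℕ),
          Ideal.span (Set.range u) = maximalIdeal S → (maximalIdeal S).spanFinrank = n → (∃ i, 0 < w i) →
          Ideal.span {x | ∃ i, 0 < w i ∧ x = u i} = P →
          (∀ m : ℕ, weightedMonomialIdeal u w m = jFlatT S f m) →
          WeightedDropHom iotaFlatT S f P u w) :
    CanonicalGameClauseHomLE 3 p iotaFlatT jFlatT := by
  refine canonicalGameClauseHomLE_three_of_weightedPresentation p fun k₀ _ _ _ S _ _ _ _ f hd hf0 hf2 P _ hreg hfP hE => ?_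
  obtain ⟨n, u, w, h1, h2, h3, h4, h5⟩ := weightedPresentation_three p k₀ S hd hf0 hf2 P hfP hE
  exact ⟨n, u, w, h1, h2, h3, h4, h5, hDROP k₀ S f hd hf0 hf2 P hreg hfP hE n u w h1 h2 h3 h4 h5⟩

/-- **GAP LIST OF RECORD (named-pair form) — hD + (DROP)₃**: `PRungGrHomLE 3 p iotaFlatT jFlatT` from hD ((desc-τ) as typed; typing
item) and (DROP)₃; (PRES)₃ discharged by `weightedPresentation_three`. [OURS · L1 W4.3 · audit glue] -/
theorem pRungGrHomLE_three_of_tieDescent_drop (p : ℕ)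
    (hD : ∀ (T T' : Type) [CommRing T] [IsRegularLocalRing T] [CommRing T'] [IsRegularLocalRing T'] [Algebra T T']
      [IsLocalHom (algebraMap T T')] [Algebra.FormallySmooth T T'] [Algebra.EssFiniteType T T'] (g : T),
      ringKrullDim T' ≤ 3 → IsTiePosition T' (algebraMap T T' g) → IsTiePosition T g)
    (hDROP : ∀ (k₀ : Type) [Field k₀] [CharP k₀ p] [PerfectField k₀]
      (S : Type) [CommRing S] [Algebra k₀ S] [Algebra.EssFiniteType k₀ S] [IsRegularLocalRing S]
      (f : S), ringKrullDim S ≤ 3 → f ≠ 0 → f ∈ (maximalIdeal S) ^ 2 →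
      ∀ (P : Ideal S) [P.IsPrime], IsRegularLocalRing (S ⧸ P) → f ∈ P →
        topStratum iotaOrdEpsTau S f = {𝔮 | P ≤ 𝔮.asIdeal} →
        ∀ (n : ℕ) (u : Fin n → S) (w : Fin n → ℕ),
          Ideal.span (Set.range u) = maximalIdeal S → (maximalIdeal S).spanFinrank = n → (∃ i, 0 < w i) →
          Ideal.span {x | ∃ i, 0 < w i ∧ x = u i} = P →
          (∀ m : ℕ, weightedMonomialIdeal u w m = jFlatT S f m) →
          WeightedDropHom iotaFlatT S f P u w) :
    PRungGrHomLE 3 p iotaFlatT jFlatT :=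
  pRungGrHomLE_three_of_tieDescent_game p hD (canonicalGameClauseHomLE_three_of_drop p hDROP)

/-- **GAP LIST OF RECORD for `stub_keyRungGrHomLE_three` — hD + (DROP)₃**: `KeyRungGrHomLE 3 p` from hD ((desc-τ) as typed; door-proved by
`Iota3.isTiePosition_descent_door`; typing item) and (DROP)₃ (`WeightedDropHom iotaFlatT S f P u w` at every weighted presentation of the
canonical centre — the characteristic-`p` drop at the `t`-homogeneous points, the substance of the crux).  (PRES)₃ of
`keyRungGrHomLE_three_of_pres_drop` is discharged by `weightedPresentation_three`. [OURS · L1 W4.3 · audit glue] -/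
theorem keyRungGrHomLE_three_of_tieDescent_drop (p : ℕ)
    (hD : ∀ (T T' : Type) [CommRing T] [IsRegularLocalRing T] [CommRing T'] [IsRegularLocalRing T'] [Algebra T T']
      [IsLocalHom (algebraMap T T')] [Algebra.FormallySmooth T T'] [Algebra.EssFiniteType T T'] (g : T),
      ringKrullDim T' ≤ 3 → IsTiePosition T' (algebraMap T T' g) → IsTiePosition T g)
    (hDROP : ∀ (k₀ : Type) [Field k₀] [CharP k₀ p] [PerfectField k₀]
      (S : Type) [CommRing S] [Algebra k₀ S] [Algebra.EssFiniteType k₀ S] [IsRegularLocalRing S]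
      (f : S), ringKrullDim S ≤ 3 → f ≠ 0 → f ∈ (maximalIdeal S) ^ 2 →
      ∀ (P : Ideal S) [P.IsPrime], IsRegularLocalRing (S ⧸ P) → f ∈ P →
        topStratum iotaOrdEpsTau S f = {𝔮 | P ≤ 𝔮.asIdeal} →
        ∀ (n : ℕ) (u : Fin n → S) (w : Fin n → ℕ),
          Ideal.span (Set.range u) = maximalIdeal S → (maximalIdeal S).spanFinrank = n → (∃ i, 0 < w i) →
          Ideal.span {x | ∃ i, 0 < w i ∧ x = u i} = P →
          (∀ m : ℕ, weightedMonomialIdeal u w m = jFlatT S f m) →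
          WeightedDropHom iotaFlatT S f P u w) :
    KeyRungGrHomLE 3 p :=
  keyRungGrHomLE_three_of_pres_drop p hD
    (fun k₀ _ _ _ S _ _ _ _ _ hd hf0 hf2 P _ _ hfP hE => weightedPresentation_three p k₀ S hd hf0 hf2 P hfP hE) hDROP

/-- **GAP LIST OF RECORD, (c11)-form — (c11)≤3 + (DROP)₃**: `KeyRungGrHomLE 3 p` from the rung clause (c11)≤3
`IotaJEssSmoothCompatibleLE 3 iotaFlatT jFlatT` AS TYPED (typing item; door-proved) and (DROP)₃ alone
(`keyRungGrHomLE_three_of_c11_game` + `canonicalGameClauseHomLE_three_of_drop`). [OURS · L1 W4.3 · audit glue] -/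
theorem keyRungGrHomLE_three_of_c11_drop (p : ℕ) (hc11 : IotaJEssSmoothCompatibleLE 3 iotaFlatT jFlatT)
    (hDROP : ∀ (k₀ : Type) [Field k₀] [CharP k₀ p] [PerfectField k₀]
      (S : Type) [CommRing S] [Algebra k₀ S] [Algebra.EssFiniteType k₀ S] [IsRegularLocalRing S]
      (f : S), ringKrullDim S ≤ 3 → f ≠ 0 → f ∈ (maximalIdeal S) ^ 2 →
      ∀ (P : Ideal S) [P.IsPrime], IsRegularLocalRing (S ⧸ P) → f ∈ P →
        topStratum iotaOrdEpsTau S f = {𝔮 | P ≤ 𝔮.asIdeal} →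
        ∀ (n : ℕ) (u : Fin n → S) (w : Fin n → ℕ),
          Ideal.span (Set.range u) = maximalIdeal S → (maximalIdeal S).spanFinrank = n → (∃ i, 0 < w i) →
          Ideal.span {x | ∃ i, 0 < w i ∧ x = u i} = P →
          (∀ m : ℕ, weightedMonomialIdeal u w m = jFlatT S f m) →
          WeightedDropHom iotaFlatT S f P u w) :
    KeyRungGrHomLE 3 p :=
  keyRungGrHomLE_three_of_c11_game p hc11 (canonicalGameClauseHomLE_three_of_drop p hDROP)

end Summit.ResolutionOfSingularities.ResolutionOfSingularities.Cruxes.HypersurfaceCentreConstruction.LocalEngine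

end
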